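import Summits.ValiantsHypothesis.ValiantsHypothesis.Theorems.LacunarySymmetroidMatrixDescartesIndexOneWronskianForm

/-!
# `MatrixDescartes` (stmt-ValiantsHypothesis-18050) — pivot column at index one: THE SIGN OF THE TWISTED WRONSKIAN AT A NODE IS THE
# NODE TYPE — `W_e(x₀) + x₀·R′(x₀) = e·N(x₀)·det F(x₀)` for the Rayleigh K-nomial `R` of the adjugate vector

HONEST FRAMING.  Cell `pub-symmetroid`, seat `val-sym-mdr-p2` (gen 23); helper file `--supports` the crux
`Theses.LacunarySymmetroid.MatrixDescartes` (OPEN), NO closure claim.  Completes this seat's `…IndexOneWronskianForm` (p678654: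
`W_e = yᵀ𝔼_e y`, `y = adj(𝔻)w`; at a root `y(x₀)` is a kernel vector) for conjb-1's index-one pivot column.  Nothing here bears on
`MatrixDescartes` in its window, on `stub_twoSided`, on `DoorA26` / `DoorA34`, the census registers, or `VP ≠ VNP`.

CONTENT.  Fix a real point `x₀` and the real vector `y₀ := adj(𝔻(x₀)) w`.  The RAYLEIGH K-NOMIAL of `y₀` is the scalar pencil
`R(X) := y₀ᵀ F(X) y₀ = X^e·y₀ᵀ(A − wwᵀ)y₀ + ∑ₖ X^{dₖ}·y₀ᵀPₖy₀` (the chain method's object at a node).  Then (symmetric letters, every `x₀`):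
  **`twistedWronskian_add_euler_rayleigh`:  W_e(x₀) + x₀·R′(x₀) = e · N(x₀) · det F(x₀)`**,  `N = wᵀadj(𝔻)w`.
Hence AT A POSITIVE ROOT `x₀` of `det F` (`twistedWronskian_eval_root`): `W_e(x₀) = −x₀·R′(x₀)` — the twisted Wronskian is NEGATIVE at
ascending nodes and POSITIVE at descending nodes (`y₀ ≠ 0` is a kernel vector there, p678654 `pivot_mulVec_adj_eq_zero_of_root`), so between two
consecutive roots of the SAME type `W_e` has an even number (≥ 0) of sign changes and between roots of opposite type an odd number (≥ 1): the
secular Rolle zero of `W_e` in each gap (conjb-1) is forced exactly at the type alternations, and the dent census counts the rest.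

[folklore] Polynomial calculus over `ℝ[X]` (Euler operator `X·d/dX` on a lacunary pencil) and the identities of p678654.
Axioms `propext`, `Classical.choice`, `Quot.sound`.
-/

set_option linter.dupNamespace false

namespace Summit.ValiantsHypothesis.ValiantsHypothesis.Theorems.LacunarySymmetroidMatrixDescartes.SecularRolle

open Polynomial Matrix Finset
open scoped BigOperators

variable {m K : ℕ}

local notation3 (prettyPrint := false) "𝔻[" e ", " d ", " A ", " P "]" =>
  ((X : ℝ[X]) ^ (e : ℕ)) • (A : Matrix (Fin _) (Fin _) ℝ).map Polynomial.C
    + ∑ k, ((X : ℝ[X]) ^ (d : Fin _ → ℕ) k) • ((P : Fin _ → Matrix (Fin _) (Fin _) ℝ) k).map Polynomial.C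

local notation3 (prettyPrint := false) "𝕔[" w "]" => (fun i => Polynomial.C ((w : Fin _ → ℝ) i))

/-- **Euler derivative of a Rayleigh K-nomial.**  For a real vector `v` and the pencil `𝔻[e, d, B, P]` (any real `B`):
`x · R′(x) = e·x^e·vᵀBv + ∑ₖ dₖ·x^{dₖ}·vᵀPₖv` where `R(X) = vᵀ 𝔻 v`. [folklore] -/
theorem euler_rayleigh_eval (e : ℕ) (d : Fin K → ℕ) (B : Matrix (Fin m) (Fin m) ℝ)
    (P : Fin K → Matrix (Fin m) (Fin m) ℝ) (v : Fin m → ℝ) (x : ℝ) :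
    x * (derivative (𝕔[v] ⬝ᵥ ((𝔻[e, d, B, P]) *ᵥ 𝕔[v]))).eval x
      = (e : ℝ) * x ^ e * (v ⬝ᵥ (B *ᵥ v)) + ∑ k, (d k : ℝ) * x ^ d k * (v ⬝ᵥ (P k *ᵥ v)) := by
  -- derivative through the constant vector, then the Euler operator on the matrix
  have h1 : derivative (𝕔[v] ⬝ᵥ ((𝔻[e, d, B, P]) *ᵥ 𝕔[v]))
      = 𝕔[v] ⬝ᵥ ((𝔻[e, d, B, P]).map derivative *ᵥ 𝕔[v]) := by
    rw [derivative_dotProduct_const]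
    congr 1
    have h := mulVec_derivative (𝔻[e, d, B, P]) 𝕔[v]
    have hc : (fun i => derivative ((𝕔[v] : Fin m → ℝ[X]) i)) = 0 := by
      funext i; simp
    rw [hc, Matrix.mulVec_zero, add_zero] at h
    exact h
  have h2 : Polynomial.C x * derivative (𝕔[v] ⬝ᵥ ((𝔻[e, d, B, P]) *ᵥ 𝕔[v]))
      = (𝕔[v] ⬝ᵥ ((Polynomial.C x • (𝔻[e, d, B, P]).map derivative) *ᵥ 𝕔[v])) := by
    rw [h1, Matrix.smul_mulVec, dotProduct_smul, smul_eq_mul]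
  have h3 : (Polynomial.C x * derivative (𝕔[v] ⬝ᵥ ((𝔻[e, d, B, P]) *ᵥ 𝕔[v]))).eval x
      = x * (derivative (𝕔[v] ⬝ᵥ ((𝔻[e, d, B, P]) *ᵥ 𝕔[v]))).eval x := by
    rw [Polynomial.eval_mul, Polynomial.eval_C]
  rw [← h3, h2, eval_dotProduct_mulVec]
  -- evaluate the Euler-weighted matrix: at the point `x`, `C x • 𝔻′` evaluates like `X • 𝔻′`
  have hX : ((Polynomial.C x • (𝔻[e, d, B, P]).map derivative).map (Polynomial.eval x))
      = (((X : ℝ[X]) • (𝔻[e, d, B, P]).map derivative).map (Polynomial.eval x)) := by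
    refine Matrix.ext fun i j => ?_
    simp only [Matrix.map_apply, Matrix.smul_apply, smul_eq_mul, Polynomial.eval_mul, Polynomial.eval_C,
      Polynomial.eval_X]
  have hE : (((X : ℝ[X]) • (𝔻[e, d, B, P]).map derivative).map (Polynomial.eval x))
      = ((e : ℝ) * x ^ e) • B + ∑ k, ((d k : ℝ) * x ^ d k) • P k := by
    rw [X_smul_skeleton_derivative]
    refine Matrix.ext fun i j => ?_
    simp only [Matrix.map_apply, Matrix.add_apply, Matrix.sum_apply, Matrix.smul_apply, smul_eq_mul,
      Polynomial.eval_add, Polynomial.eval_finsetSum, Polynomial.eval_mul, Polynomial.eval_C, Polynomial.eval_pow,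
      Polynomial.eval_X, mul_assoc]
  have hv : (fun i => ((𝕔[v] : Fin m → ℝ[X]) i).eval x) = v := by funext i; simp
  rw [hX, hE, hv]
  simp only [Matrix.add_mulVec, Matrix.sum_mulVec, Matrix.smul_mulVec, dotProduct_add, dotProduct_sum,
    dotProduct_smul, smul_eq_mul]

/-- `yᵀ 𝔻(x) y = det 𝔻(x) · (wᵀ y)` for `y = adj(𝔻(x)) w` (real point). [folklore] -/
theorem form_skeleton_real (e : ℕ) (d : Fin K → ℕ) (A : Matrix (Fin m) (Fin m) ℝ) (w : Fin m → ℝ)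
    (P : Fin K → Matrix (Fin m) (Fin m) ℝ) (x : ℝ) :
    ((x ^ e • A + ∑ k, x ^ d k • P k).adjugate *ᵥ w) ⬝ᵥ
        ((x ^ e • A + ∑ k, x ^ d k • P k) *ᵥ ((x ^ e • A + ∑ k, x ^ d k • P k).adjugate *ᵥ w))
      = (x ^ e • A + ∑ k, x ^ d k • P k).det * (w ⬝ᵥ ((x ^ e • A + ∑ k, x ^ d k • P k).adjugate *ᵥ w)) := by
  rw [Matrix.mulVec_mulVec, Matrix.mul_adjugate, Matrix.smul_mulVec, Matrix.one_mulVec, dotProduct_smul,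
    smul_eq_mul, dotProduct_comm]

/-- **`W_e(x₀) + x₀·R′(x₀) = e · N(x₀) · det F(x₀)`** for every real `x₀`, where `y₀ = adj(𝔻(x₀)) w`,
`R(X) = y₀ᵀ(X^e(A − wwᵀ) + ∑ X^{dₖ}Pₖ)y₀` is the Rayleigh K-nomial of `y₀`, `N = wᵀadj(𝔻)w`, `F = X^e(A − wwᵀ) + ∑ X^{dₖ}Pₖ`
(symmetric letters). [folklore] -/
theorem twistedWronskian_add_euler_rayleigh (e : ℕ) (d : Fin K → ℕ) {A : Matrix (Fin m) (Fin m) ℝ} (w : Fin m → ℝ)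
    {P : Fin K → Matrix (Fin m) (Fin m) ℝ} (hA : A.IsSymm) (hP : ∀ k, (P k).IsSymm) (x : ℝ) :
    (twistedWronskian e (𝕔[w] ⬝ᵥ ((𝔻[e, d, A, P]).adjugate *ᵥ 𝕔[w])) (Matrix.det (𝔻[e, d, A, P]))).eval x
      + x * (derivative (𝕔[(x ^ e • A + ∑ k, x ^ d k • P k).adjugate *ᵥ w]
            ⬝ᵥ ((𝔻[e, d, (A - vecMulVec w w), P]) *ᵥ 𝕔[(x ^ e • A + ∑ k, x ^ d k • P k).adjugate *ᵥ w]))).eval x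
      = (e : ℝ) * (w ⬝ᵥ ((x ^ e • A + ∑ k, x ^ d k • P k).adjugate *ᵥ w))
          * (x ^ e • (A - vecMulVec w w) + ∑ k, x ^ d k • P k).det := by
  set y₀ : Fin m → ℝ := (x ^ e • A + ∑ k, x ^ d k • P k).adjugate *ᵥ w with hy₀
  rw [twistedWronskian_skeleton_eval e d w hA hP x, euler_rayleigh_eval e d (A - vecMulVec w w) P y₀ x, ← hy₀,
    det_pivot_real_eq, ← hy₀]
  -- `y₀ᵀ(A − wwᵀ)y₀ = y₀ᵀAy₀ − (w·y₀)²` and `x^e y₀ᵀAy₀ + ∑ x^{dₖ} y₀ᵀPₖy₀ = det 𝔻(x)·(w·y₀)`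
  have hsub : y₀ ⬝ᵥ ((A - vecMulVec w w) *ᵥ y₀) = y₀ ⬝ᵥ (A *ᵥ y₀) - (w ⬝ᵥ y₀) * (w ⬝ᵥ y₀) := by
    rw [Matrix.sub_mulVec, dotProduct_sub, vecMulVec_mulVec_eq, dotProduct_smul, smul_eq_mul, dotProduct_comm y₀ w]
  have hform : x ^ e * (y₀ ⬝ᵥ (A *ᵥ y₀)) + ∑ k, x ^ d k * (y₀ ⬝ᵥ (P k *ᵥ y₀))
      = (x ^ e • A + ∑ k, x ^ d k • P k).det * (w ⬝ᵥ y₀) := by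
    have h := form_skeleton_real e d A w P x
    rw [← hy₀] at h
    rw [← h]
    simp only [Matrix.add_mulVec, Matrix.sum_mulVec, Matrix.smul_mulVec, dotProduct_add, dotProduct_sum,
      dotProduct_smul, smul_eq_mul]
  rw [hsub]
  have hsplit : ∑ k, ((e : ℝ) - (d k : ℝ)) * x ^ d k * (y₀ ⬝ᵥ (P k *ᵥ y₀)) + (↑e * x ^ e * (y₀ ⬝ᵥ (A *ᵥ y₀)
        - (w ⬝ᵥ y₀) * (w ⬝ᵥ y₀)) + ∑ k, (d k : ℝ) * x ^ d k * (y₀ ⬝ᵥ (P k *ᵥ y₀)))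
      = (e : ℝ) * (x ^ e * (y₀ ⬝ᵥ (A *ᵥ y₀)) + ∑ k, x ^ d k * (y₀ ⬝ᵥ (P k *ᵥ y₀)))
        - (e : ℝ) * x ^ e * ((w ⬝ᵥ y₀) * (w ⬝ᵥ y₀)) := by
    have hs : ∑ k, ((e : ℝ) - (d k : ℝ)) * x ^ d k * (y₀ ⬝ᵥ (P k *ᵥ y₀))
          + ∑ k, (d k : ℝ) * x ^ d k * (y₀ ⬝ᵥ (P k *ᵥ y₀))
        = (e : ℝ) * ∑ k, x ^ d k * (y₀ ⬝ᵥ (P k *ᵥ y₀)) := by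
      rw [← Finset.sum_add_distrib, Finset.mul_sum]
      exact Finset.sum_congr rfl fun k _ => by ring
    linear_combination hs
  rw [hsplit, hform, dotProduct_comm w y₀]
  ring

/-- **AT A ROOT: `W_e(x₀) = −x₀·R′(x₀)`** — the twisted Wronskian at a positive root `x₀` of `det F` is minus the Euler slope of the
Rayleigh K-nomial of the kernel vector `y₀ = adj(𝔻(x₀)) w` (negative at ascending nodes, positive at descending nodes). [folklore] -/
theorem twistedWronskian_eval_root (e : ℕ) (d : Fin K → ℕ) {A : Matrix (Fin m) (Fin m) ℝ} (w : Fin m → ℝ)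
    {P : Fin K → Matrix (Fin m) (Fin m) ℝ} (hA : A.IsSymm) (hP : ∀ k, (P k).IsSymm) {x : ℝ}
    (hroot : (x ^ e • (A - vecMulVec w w) + ∑ k, x ^ d k • P k).det = 0) :
    (twistedWronskian e (𝕔[w] ⬝ᵥ ((𝔻[e, d, A, P]).adjugate *ᵥ 𝕔[w])) (Matrix.det (𝔻[e, d, A, P]))).eval x
      = -(x * (derivative (𝕔[(x ^ e • A + ∑ k, x ^ d k • P k).adjugate *ᵥ w]
            ⬝ᵥ ((𝔻[e, d, (A - vecMulVec w w), P]) *ᵥ 𝕔[(x ^ e • A + ∑ k, x ^ d k • P k).adjugate *ᵥ w]))).eval x) := by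
  have h := twistedWronskian_add_euler_rayleigh e d w hA hP x
  rw [hroot, mul_zero] at h
  linarith

end Summit.ValiantsHypothesis.ValiantsHypothesis.Theorems.LacunarySymmetroidMatrixDescartes.SecularRolle
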